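import Summits.Ventures.LatticeQCDFlow.Scaling.ExchangeOfferCeiling

/-!
HONEST FRAMING: exact (Metropolis-corrected) sampling algorithms for lattice gauge theory; figures
of merit are autocorrelation/cost numbers at stated couplings and volumes; no continuum-physics
claim.

# OneSidedHubRateLaw — THE HUB RATE LAW, EVERY TERM MATCHED: UNDER ONE-SIDED DOMINATION `p·μ_{k+1} ≤ μ_0` THE HOT-ONLY
# STAR HAS `p·min{t, γ₀(1−t)}/(14K) ≤ Gap ≤ min{ t·min{μ_0(A),μ_0(Aᶜ)}/(Kv), (1−t)·Q_0(A,Aᶜ)/((K+1)v),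
# 2t·(μ_0(u)/μ_{k+1}(u))/K }` — THE SWAP BUDGET `t`, THE HOT TUNNELLING `γ₀(1−t)` (AGAINST THE HOT EXIT FLOW
# `(1−t)Q_0`), THE DOMINATION RATIO `p` AND THE POWER `K⁻¹` EACH APPEAR ON BOTH SIDES (lean-2 GEN-22, ours)

Venture-side (OURS).  Cell `lqcd-flow` (pub-lqcd), unit `pub-lqcd-lean-2-g22`, 2026-08-26.  Chapter J, file 13:
the chapter's summary theorem for the hot-only hub (identity maps; maps conjugate it by `Scaling/FlowHubSchemeFloor`).
The floor is `Scaling/OneSidedHubFloor` (J8).  The three ceilings: (i) HANDOVER — `Scaling/ExchangeSchemeHandover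
Ceiling.handover_spectralGap_le` with the cold sector count (no swap budget, no relaxation of the cold replicas);
(ii) TUNNELLING — `….weightedScheme_spectralGap_le_sectorCount` with the full sector count, which every identity-map
swap preserves and only the hot update changes, at rate `w_0·Q_0(A,Aᶜ) = Q_0(A,Aᶜ)` (no fresh sector labels, no
relaxation: tempering imports tunnelling, it does not create it); (iii) OFFER — `Scaling/ExchangeOfferCeiling` (J10)
(no domination at a configuration, no refresh of a replica sitting there).  Since the hot update's Poincaré constant
satisfies `γ₀·μ_0(A)μ_0(Aᶜ) ≤ Q_0(A,Aᶜ)` (the indicator of `A`), ceiling (ii) is the `γ₀(1−t)` term of the floor up to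
the sector masses.

## What is proved

* `allSectorMass_ge` (`Σ_k μ_k(A)μ_k(Aᶜ) ≥ (K+1)v`); `hot_poincare_le_exitFlow` (`γ₀·μ_0(A)μ_0(Aᶜ) ≤ Q_0(A,Aᶜ)`).
* **`hotOnlyStar_spectralGap_le_tunneling`** — `Gap ≤ (1−t)·Q_0(A,Aᶜ)/((K+1)v)` (any levels with
  `μ_k(A)μ_k(Aᶜ) ≥ v > 0`, hot-only updates, identity-map star; no domination needed).
* **`oneSidedHotOnlyStar_rateLaw`** — floor and the three ceilings together.

NOT CLAIMED: matching constants (`14` vs `1`, `2`); which ceiling bites is instance-dependent; anything measured.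
Literature grade (cell rule): ELEMENTARY COROLLARIES of the tree's floors and ceilings; nothing cited as a fact; no
new bib keys.
-/

noncomputable section

open Finset Function
open Literature.Probability.MarkovChains

namespace Summit.Ventures.LatticeQCDFlow.Scaling

section RateLaw

variable {S : Type*} [Fintype S] [DecidableEq S] {K : ℕ} {μ : Fin (K + 1) → S → ℝ}
  {M : Fin (K + 1) → S → S → ℝ} {t : ℝ}

/-- All-level sector masses: `μ_k(A)μ_k(Aᶜ) ≥ v` for every `k` gives `Σ_k μ_k(A)μ_k(Aᶜ) ≥ (K+1)·v`. [ours] -/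
theorem allSectorMass_ge {A : Finset S} {v : ℝ} (hv : ∀ k : Fin (K + 1), v ≤ (∑ u ∈ A, μ k u) * ∑ u ∈ Aᶜ, μ k u) :
    ((K : ℝ) + 1) * v ≤ ∑ k : Fin (K + 1), (∑ u ∈ A, μ k u) * ∑ u ∈ Aᶜ, μ k u := by
  calc ((K : ℝ) + 1) * v = ∑ _k : Fin (K + 1), v := by
        rw [sum_const, card_univ, Fintype.card_fin, nsmul_eq_mul]; push_cast; ring
    _ ≤ _ := sum_le_sum fun k _ => hv k

/-- **A Poincaré constant is at most the exit flow over the sector masses:** `γ₀·μ_0(A)·μ_0(Aᶜ) ≤ Q_0(A, Aᶜ)` for a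
`μ_0`-reversible row-stochastic `M_0` with `γ₀·Var ≤ 𝓔` (test function `1_A`). [ours] -/
theorem hot_poincare_le_exitFlow {ν : S → ℝ} (hν1 : ∑ u, ν u = 1) {M0 : Matrix S S ℝ}
    (hM0 : IsRowStochastic M0) (hrev : DetailedBalance ν M0) {γ₀ : ℝ}
    (hgap : ∀ h : S → ℝ, γ₀ * lawVariance ν h ≤ dirichletForm ν M0 h) (A : Finset S) :
    γ₀ * ((∑ u ∈ A, ν u) * ∑ u ∈ Aᶜ, ν u) ≤ edgeMeasure ν M0 A Aᶜ := by
  have h := hgap (fun u => if u ∈ A then (1 : ℝ) else 0)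
  have hhalf : ∀ a : ℝ, (1 : ℝ) / 2 * (a + a) = a := fun a => by ring
  have hcompl : ∑ u ∈ Aᶜ, ν u = 1 - ∑ u ∈ A, ν u := by
    have := sum_add_sum_compl A ν; rw [hν1] at this; linarith
  rw [lawVariance_setIndicator hν1, dirichletForm_setIndicator, ← edgeMeasure_compl_comm hM0 (hrev.isStationary hM0.2),
    hhalf] at h
  rwa [hcompl]

/-- **THE TUNNELLING CEILING OF THE HOT-ONLY STAR:** identity-map star, every update on the hot replica, any levels
with `μ_k(A)μ_k(Aᶜ) ≥ v > 0` for all `k`: `Gap ≤ (1−t)·Q_0(A,Aᶜ)/((K+1)·v)` — fresh sector labels are minted only by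
the hot update (`0 ≤ t ≤ 1`, `|S| ≥ 2`; no domination hypothesis). [ours] -/
theorem hotOnlyStar_spectralGap_le_tunneling [Nontrivial S] (hμ : ∀ k x, 0 < μ k x) (hμ1 : ∀ k, ∑ u, μ k u = 1)
    (hM : ∀ k, IsRowStochastic (M k)) (hMrev : ∀ k, DetailedBalance (μ k) (M k)) (ht0 : 0 ≤ t) (ht1 : t ≤ 1)
    {A : Finset S} {v : ℝ} (hvpos : 0 < v) (hv : ∀ k : Fin (K + 1), v ≤ (∑ u ∈ A, μ k u) * ∑ u ∈ Aᶜ, μ k u) :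
    spectralGap (tensorFun μ) (fun x y : Fin (K + 1) → S =>
        t * ptGraphSwap μ (fun k : Fin K => ((0 : Fin (K + 1)), k.succ)) (fun _ : Fin K => Equiv.refl S) x y
          + (1 - t) * prodKernel (fun k : Fin (K + 1) => if k = 0 then (1 : ℝ) else 0) M x y)
      ≤ (1 - t) * edgeMeasure (μ 0) (M 0) A Aᶜ / (((K : ℝ) + 1) * v) := by
  set e : Fin K → Fin (K + 1) × Fin (K + 1) := fun k => ((0 : Fin (K + 1)), k.succ) with he_def
  have he : ∀ j, (e j).1 ≠ (e j).2 := fun k => (Fin.succ_ne_zero k).symm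
  have hw0 : ∀ k : Fin (K + 1), 0 ≤ (if k = 0 then (1 : ℝ) else 0) := fun k => by positivity
  have hQ := ptGraphSwap_isRowStochastic (e := e) (φ := fun _ : Fin K => Equiv.refl S) hμ
  have hQrev := ptGraphSwap_detailedBalance (e := e) (φ := fun _ : Fin K => Equiv.refl S) hμ
  have hQA := ptGraphSwap_one_sectorCount_eq (e := e) he hμ A
  have hVge := allSectorMass_ge (μ := μ) hv
  have hVpos : 0 < ∑ k : Fin (K + 1), (∑ u ∈ A, μ k u) * ∑ u ∈ Aᶜ, μ k u :=
    lt_of_lt_of_le (mul_pos (by positivity) hvpos) hVge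
  have h := weightedScheme_spectralGap_le_sectorCount (w := fun k : Fin (K + 1) => if k = 0 then (1 : ℝ) else 0)
    hμ hμ1 hM hMrev hw0 hotOnlyWeight_sum ht0 ht1 hQ hQrev hQA hVpos
  have hsum : ∑ k : Fin (K + 1), (if k = 0 then (1 : ℝ) else 0) * edgeMeasure (μ k) (M k) A Aᶜ
      = edgeMeasure (μ 0) (M 0) A Aᶜ := by
    rw [Finset.sum_eq_single (0 : Fin (K + 1)) (fun k _ hk => by rw [if_neg hk, zero_mul])
      (fun h => absurd (mem_univ _) h), if_pos rfl, one_mul]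
  rw [hsum] at h
  have hnum : 0 ≤ (1 - t) * edgeMeasure (μ 0) (M 0) A Aᶜ :=
    mul_nonneg (by linarith) (edgeMeasure_nonneg (fun u => (hμ 0 u).le) (hM 0).1 A Aᶜ)
  exact h.trans (div_le_div_of_nonneg_left hnum (by positivity) hVge)

/-- **THE HUB RATE LAW:** hot-only star with identity maps, one-sided domination `p·μ_{k+1} ≤ μ_0` (`0 < p ≤ 1`),
hot update `μ_0`-reversible with Poincaré constant `γ₀`, `0 < t < 1`, `K ≥ 1`, `|S| ≥ 2`, a set `A` with
`μ_k(A)μ_k(Aᶜ) ≥ v > 0` at every level: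
**floor** `p·min{t, γ₀(1−t)}/(14K) ≤ Gap`;
**handover** `Gap ≤ t·min{μ_0(A), μ_0(Aᶜ)}/(K·v)`;
**tunnelling** `Gap ≤ (1−t)·Q_0(A,Aᶜ)/((K+1)·v)` (and `γ₀·μ_0(A)μ_0(Aᶜ) ≤ Q_0(A,Aᶜ)`);
**offer** `Gap ≤ 2t·(μ_0(u)/μ_{k+1}(u))/K` for every cold level `k+1` and `u` with `μ_{k+1}(u) ≤ ½`. [ours] -/
theorem oneSidedHotOnlyStar_rateLaw [Nontrivial S] (hK : 1 ≤ K) (hμ : ∀ k x, 0 < μ k x)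
    (hμ1 : ∀ k, ∑ u, μ k u = 1) (hM : ∀ k, IsRowStochastic (M k)) (hMrev : ∀ k, DetailedBalance (μ k) (M k))
    (ht0 : 0 < t) (ht1 : t < 1) {p γ₀ : ℝ} (hp : 0 < p) (hp1 : p ≤ 1) (hγ₀ : 0 < γ₀)
    (hdom : ∀ (k : Fin K) (u : S), p * μ k.succ u ≤ μ 0 u)
    (hgap0 : ∀ h : S → ℝ, γ₀ * lawVariance (μ 0) h ≤ dirichletForm (μ 0) (M 0) h) {A : Finset S} {v : ℝ}
    (hvpos : 0 < v) (hv : ∀ k : Fin (K + 1), v ≤ (∑ u ∈ A, μ k u) * ∑ u ∈ Aᶜ, μ k u) :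
    p * min t (γ₀ * (1 - t)) / (14 * K)
        ≤ spectralGap (tensorFun μ) (fun x y : Fin (K + 1) → S =>
            t * ptGraphSwap μ (fun k : Fin K => ((0 : Fin (K + 1)), k.succ)) (fun _ : Fin K => Equiv.refl S) x y
              + (1 - t) * prodKernel (fun k : Fin (K + 1) => if k = 0 then (1 : ℝ) else 0) M x y)
      ∧ spectralGap (tensorFun μ) (fun x y : Fin (K + 1) → S =>
            t * ptGraphSwap μ (fun k : Fin K => ((0 : Fin (K + 1)), k.succ)) (fun _ : Fin K => Equiv.refl S) x y
              + (1 - t) * prodKernel (fun k : Fin (K + 1) => if k = 0 then (1 : ℝ) else 0) M x y)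
          ≤ t * min (∑ u ∈ A, μ 0 u) (∑ u ∈ Aᶜ, μ 0 u) / (K * v)
      ∧ (spectralGap (tensorFun μ) (fun x y : Fin (K + 1) → S =>
            t * ptGraphSwap μ (fun k : Fin K => ((0 : Fin (K + 1)), k.succ)) (fun _ : Fin K => Equiv.refl S) x y
              + (1 - t) * prodKernel (fun k : Fin (K + 1) => if k = 0 then (1 : ℝ) else 0) M x y)
          ≤ (1 - t) * edgeMeasure (μ 0) (M 0) A Aᶜ / (((K : ℝ) + 1) * v)
        ∧ γ₀ * ((∑ u ∈ A, μ 0 u) * ∑ u ∈ Aᶜ, μ 0 u) ≤ edgeMeasure (μ 0) (M 0) A Aᶜ)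
      ∧ ∀ (k : Fin K) (u : S), μ k.succ u ≤ 1 / 2 →
        spectralGap (tensorFun μ) (fun x y : Fin (K + 1) → S =>
            t * ptGraphSwap μ (fun k : Fin K => ((0 : Fin (K + 1)), k.succ)) (fun _ : Fin K => Equiv.refl S) x y
              + (1 - t) * prodKernel (fun k : Fin (K + 1) => if k = 0 then (1 : ℝ) else 0) M x y)
          ≤ 2 * t * (μ 0 u / μ k.succ u) / K := by
  have two := oneSidedHotOnlyStar_spectralGap_two_sided (M := M) hK hμ hμ1 hM hMrev ht0 ht1 hp hp1 hγ₀ hdom hgap0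
    (A := A) hvpos (fun k _ => hv k)
  refine ⟨two.1, two.2, ⟨hotOnlyStar_spectralGap_le_tunneling hμ hμ1 hM hMrev ht0.le ht1.le hvpos hv,
    hot_poincare_le_exitFlow (hμ1 0) (hM 0) (hMrev 0) hgap0 A⟩, fun k u hu => ?_⟩
  exact (oneSidedHotOnlyStar_twoSided_domination (M := M) hK hμ hμ1 hM hMrev ht0 ht1 hp hp1 hγ₀ hdom hgap0 k hu).2

end RateLaw

end Summit.Ventures.LatticeQCDFlow.Scaling

end
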